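import Summits.QuantumFields.BalabanUV.Beta.GAN24.ResolventLegCharges
import Literature.MathematicalPhysics.QuantumFieldTheory.Balaban1983to89.Beta.OneStepKernelFamily

/-!
# `BalabanUV.Beta.GAN24.SlotWeightedVertex` — binder row G-an2-4 ∕ (CONV-C), W-slot CT-W, conservation law (C)∕(C)sym AT LEVELS `j ≥ 1`, T2b-(ii) of this lineage's note
# `HOME/b2b-balaban-gan24-formalise-leaf-04/g68/EXIT-FACE-CURRENT-TOWER.md`: **THE SLOT-WEIGHTED SUPERPOSITION OF THE CHAIN-RULE VERTEX IS THE TABLE CONTRACTED WITH THE FIELD RESPONSE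
# TO THE SLOT DATUM** — `Σ'_t σ(t)·vertexOfK K N S ν t x z a b = Σ_κ″ Σ'_u (Σ'_t σ(t)·colH K N ν t κ″ u)·S κ″ u x z a b` for a decaying `K`, a local `S`, a bounded `σ`

NOT IN PRINT; OUR BOOKKEEPING ([folklore] `tsum` bookkeeping BY NAME over an2's `OneStepKernelFamily` (`vertexOfK`, `colH`, `abs_colH_le`), an5∕an2's `ExpKernelCalculus` (`exp_split`,
`summable_exp_shift`, `tsum_exp_shift`), `ResolventLegCharges.summable_exp_coarse′`; G-an2-4 formalisation swarm, leaf prover `b2b-balaban-gan24-formalise-leaf-04`, gen 68).  HONEST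
FRAMING (cell contract, verbatim): «discharging `BetaPertH` makes Bałaban's UV stability UNCONDITIONAL — a real constructive-QFT result; it is NOT the continuum limit and NOT the Clay
problem.»  HONEST DEPENDENCY (verbatim): «continuum YM on T⁴ ⇐ BetaPertH ∧ nine spine estimates (0/9 proved); BetaPertH ⇐ (D1) ∧ (D4) ∧ CAP+tail; G-an2-4 gates asym, D1 and NE2/3/4.»

WHY.  In `ExitFaceCurrentDivStep.div_faceSlot_current_eq` the level-`(j+1)` divergence is the slot-weighted, leg-weighted block gauge read of `G_j ∘ vertexOfK G_j Lc S ν t`; to recognise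
a LEVEL-`j` CURRENT of the same shape (slot datum `H_j(σ ê_ν)`, leg datum `H_j(ρ ê_β)`) the slot weight must be pushed through the chain-rule vertex onto the H-columns: this file.

WHAT ([folklore]; generic `d`, blocking `N ≥ 1`; 0 `def`, 0 cited facts, 0 `def … : Prop`, 0 sorry): `summable_slot_col_table` (the `(t, u)` family is absolutely summable),
**`tsum_slotWeight_vertexOfK`** (the headline), `summable_slotWeight_colH` (the superposed column `u ↦ Σ'_t σ(t)·colH K N ν t κ″ u` is well defined and bounded by `C·Z`).  Asserts NO
value of Bałaban's tables; discharges NOTHING of (C)sym ∕ (Q-D) ∕ (Q-D-rate) ∕ «T2Shape» ∕ «T2Drift» ∕ (hW, hWall); NEVER «G-an2-4 closed» as (CONV-C); NOT D1, NOT `BetaPertH`, NOT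
continuum, NOT Clay.  2026-08-23; no existing file touched.
-/

noncomputable section

open Finset
open scoped BigOperators
open Literature.MathematicalPhysics.QuantumFieldTheory
open Literature.MathematicalPhysics.QuantumFieldTheory.Balaban1983to89
open Literature.MathematicalPhysics.QuantumFieldTheory.Balaban1983to89.Beta
open B12Sec2to5 (l1 l1_nonneg)
open ExpKernelCalculus (Site MKer Decays BiLoc Zl Zl_nonneg exp_split summable_exp_shift summable_exp_shift' tsum_exp_shift tsum_exp_shift' l1_sub_symm)
open OneStepResolventKernel (Fib LocStencil wsum)
open OneStepKernelFamily (vertexOfK colH abs_colH_le)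
open Summit.QuantumFields.BalabanUV.Beta.GAN24.ResolventLegCharges (summable_exp_coarse')

namespace Summit.QuantumFields.BalabanUV.Beta.GAN24.SlotWeightedVertex

variable {d : ℕ} {N : ℕ}

/-- [folklore] **THE `(slot, column-site)` FAMILY `σ(t)·colH K N ν t κ″ u·S κ″ u x z a b` IS ABSOLUTELY SUMMABLE** (decaying `K`, local `S`, bounded `σ`, `1 ≤ N`). -/
theorem summable_slot_col_table (hN : 1 ≤ N) {K : MKer (d + 1) (Fib d)} {C δ : ℝ} (hK : Decays K C δ) (hδ : 0 < δ)
    {S : Fin (d + 1) → Site (d + 1) → MKer (d + 1) (Fib d)} {Cs δs : ℝ} (hS : LocStencil S Cs δs) (hδs : 0 < δs)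
    {σ : Site (d + 1) → ℝ} {B : ℝ} (hσ : ∀ t, |σ t| ≤ B) (ν κ'' : Fin (d + 1)) (x z : Site (d + 1)) (a b : Fib d) :
    Summable fun tu : Site (d + 1) × Site (d + 1) => |σ tu.1 * colH K N ν tu.1 κ'' tu.2 * S κ'' tu.2 x z a b| := by
  have hC : 0 ≤ C := hK.nonneg (Sum.inl 0)
  have hCs : 0 ≤ Cs := (hS 0 0).nonneg (Sum.inl 0)
  have hB : 0 ≤ B := (abs_nonneg _).trans (hσ 0)
  obtain ⟨m, hm0, hmδ, hmδs⟩ : ∃ m : ℝ, 0 < m ∧ m ≤ δ ∧ m ≤ δs := ⟨min δ δs, lt_min hδ hδs, min_le_left _ _, min_le_right _ _⟩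
  have hm2 : 0 < m / 2 := half_pos hm0
  -- the majorant `(B·C·Cs)·e^{−(m/2)|x − u|}·e^{−(m/2)|x − N t|}` is summable on `Site × Site`
  have hMs : Summable fun tu : Site (d + 1) × Site (d + 1) =>
      (B * C * Cs) * (Real.exp (-(m - m / 2) * l1 (x - tu.2)) * Real.exp (-(m / 2) * l1 (x - (N : ℤ) • tu.1))) := by
    have hm4 : 0 < m - m / 2 := by linarith
    refine Summable.mul_left (B * C * Cs) ?_
    refine (summable_prod_of_nonneg (fun tu => mul_nonneg (Real.exp_pos _).le (Real.exp_pos _).le)).2 ⟨fun t => ?_, ?_⟩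
    · show Summable fun u : Site (d + 1) => Real.exp (-(m - m / 2) * l1 (x - u)) * Real.exp (-(m / 2) * l1 (x - (N : ℤ) • t))
      exact (summable_exp_shift hm4 x).mul_right (Real.exp (-(m / 2) * l1 (x - (N : ℤ) • t)))
    · have e : ∀ t : Site (d + 1), ∑' u : Site (d + 1), Real.exp (-(m - m / 2) * l1 (x - u)) * Real.exp (-(m / 2) * l1 (x - (N : ℤ) • t)) =
          Zl (d + 1) (m - m / 2) * Real.exp (-(m / 2) * l1 (x - (N : ℤ) • t)) := fun t => by rw [tsum_mul_right, tsum_exp_shift]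
      show Summable fun t : Site (d + 1) => ∑' u : Site (d + 1), Real.exp (-(m - m / 2) * l1 (x - u)) * Real.exp (-(m / 2) * l1 (x - (N : ℤ) • t))
      simp only [e]
      exact (summable_exp_coarse' (d := d) hN hm2 x).mul_left (Zl (d + 1) (m - m / 2))
  refine Summable.of_nonneg_of_le (fun _ => abs_nonneg _) (fun tu => ?_) hMs
  rw [abs_mul, abs_mul]
  have h1 := hσ tu.1
  have h2 : |colH K N ν tu.1 κ'' tu.2| ≤ C * Real.exp (-m * l1 (tu.2 - (N : ℤ) • tu.1)) := by
    refine (abs_colH_le hK ν tu.1 κ'' tu.2).trans (mul_le_mul_of_nonneg_left (Real.exp_le_exp.2 ?_) hC)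
    nlinarith [l1_nonneg (tu.2 - (N : ℤ) • tu.1)]
  have h3 : |S κ'' tu.2 x z a b| ≤ Cs * Real.exp (-m * l1 (x - tu.2)) := by
    refine (hS κ'' tu.2 x z a b).trans (mul_le_mul_of_nonneg_left (Real.exp_le_exp.2 ?_) hCs)
    nlinarith [l1_nonneg (x - tu.2), l1_nonneg (z - tu.2)]
  have h4 : Real.exp (-m * l1 (x - tu.2)) * Real.exp (-m * l1 (tu.2 - (N : ℤ) • tu.1)) ≤
      Real.exp (-(m - m / 2) * l1 (x - tu.2)) * Real.exp (-(m / 2) * l1 (x - (N : ℤ) • tu.1)) :=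
    exp_split hm2.le (by linarith) x tu.2 ((N : ℤ) • tu.1)
  calc |σ tu.1| * |colH K N ν tu.1 κ'' tu.2| * |S κ'' tu.2 x z a b|
      ≤ B * (C * Real.exp (-m * l1 (tu.2 - (N : ℤ) • tu.1))) * (Cs * Real.exp (-m * l1 (x - tu.2))) :=
        mul_le_mul (mul_le_mul h1 h2 (abs_nonneg _) hB) h3 (abs_nonneg _) (by positivity)
    _ = (B * C * Cs) * (Real.exp (-m * l1 (x - tu.2)) * Real.exp (-m * l1 (tu.2 - (N : ℤ) • tu.1))) := by ring
    _ ≤ (B * C * Cs) * (Real.exp (-(m - m / 2) * l1 (x - tu.2)) * Real.exp (-(m / 2) * l1 (x - (N : ℤ) • tu.1))) :=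
        mul_le_mul_of_nonneg_left h4 (by positivity)

/-- [folklore] The superposed column `u ↦ Σ'_t σ(t)·colH K N ν t κ″ u` is summable in `t` at every `u`. -/
theorem summable_slotWeight_colH (hN : 1 ≤ N) {K : MKer (d + 1) (Fib d)} {C δ : ℝ} (hK : Decays K C δ) (hδ : 0 < δ)
    {σ : Site (d + 1) → ℝ} {B : ℝ} (hσ : ∀ t, |σ t| ≤ B) (ν κ'' : Fin (d + 1)) (u : Site (d + 1)) :
    Summable fun t : Site (d + 1) => σ t * colH K N ν t κ'' u := by
  have hC : 0 ≤ C := hK.nonneg (Sum.inl 0)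
  have hB : 0 ≤ B := (abs_nonneg _).trans (hσ 0)
  refine Summable.of_norm_bounded (((summable_exp_coarse' (d := d) hN hδ u)).mul_left (B * C)) (fun t => ?_)
  rw [Real.norm_eq_abs, abs_mul]
  calc |σ t| * |colH K N ν t κ'' u| ≤ B * (C * Real.exp (-δ * l1 (u - (N : ℤ) • t))) := mul_le_mul (hσ t) (abs_colH_le hK ν t κ'' u) (abs_nonneg _) hB
    _ = B * C * Real.exp (-δ * l1 (u - (N : ℤ) • t)) := by ring

/-- [folklore] **THE SLOT-WEIGHTED SUPERPOSITION OF THE CHAIN-RULE VERTEX** (decaying `K`, local `S`, bounded `σ`, `1 ≤ N`; pointwise in the legs):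
`Σ'_t σ(t)·vertexOfK K N S ν t x z a b = Σ_κ″ Σ'_u (Σ'_t σ(t)·colH K N ν t κ″ u)·S κ″ u x z a b` — the table `S` contracted in its slot with the FIELD RESPONSE `H(σ ê_ν)` of `K` to the
multiplier datum `σ` in direction `ν`. -/
theorem tsum_slotWeight_vertexOfK (hN : 1 ≤ N) {K : MKer (d + 1) (Fib d)} {C δ : ℝ} (hK : Decays K C δ) (hδ : 0 < δ)
    {S : Fin (d + 1) → Site (d + 1) → MKer (d + 1) (Fib d)} {Cs δs : ℝ} (hS : LocStencil S Cs δs) (hδs : 0 < δs)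
    {σ : Site (d + 1) → ℝ} {B : ℝ} (hσ : ∀ t, |σ t| ≤ B) (ν : Fin (d + 1)) (x z : Site (d + 1)) (a b : Fib d) :
    ∑' t : Site (d + 1), σ t * vertexOfK K N S ν t x z a b =
      ∑ κ'' : Fin (d + 1), ∑' u : Site (d + 1), (∑' t : Site (d + 1), σ t * colH K N ν t κ'' u) * S κ'' u x z a b := by
  classical
  -- pointwise: unfold the chain-rule vertex
  have hpt : ∀ t : Site (d + 1), σ t * vertexOfK K N S ν t x z a b = ∑ κ'' : Fin (d + 1), ∑' u : Site (d + 1), σ t * colH K N ν t κ'' u * S κ'' u x z a b := by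
    intro t
    simp only [vertexOfK, OneStepResolventKernel.wsum, Finset.mul_sum]
    refine Finset.sum_congr rfl fun κ'' _ => ?_
    rw [← tsum_mul_left]
    exact tsum_congr fun u => by ring
  have hF : ∀ κ'' : Fin (d + 1), Summable fun tu : Site (d + 1) × Site (d + 1) => σ tu.1 * colH K N ν tu.1 κ'' tu.2 * S κ'' tu.2 x z a b :=
    fun κ'' => Summable.of_norm_bounded (summable_slot_col_table hN hK hδ hS hδs hσ ν κ'' x z a b) (fun tu => by rw [Real.norm_eq_abs])
  rw [tsum_congr hpt, Summable.tsum_finsetSum (fun κ'' _ => (hF κ'').prod)]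
  refine Finset.sum_congr rfl fun κ'' _ => ?_
  -- swap `t` and `u`, then pull the table entry out of the inner sum
  rw [← (hF κ'').tsum_prod, ← (Equiv.prodComm (Site (d + 1)) (Site (d + 1))).tsum_eq (fun tu : Site (d + 1) × Site (d + 1) => σ tu.1 * colH K N ν tu.1 κ'' tu.2 * S κ'' tu.2 x z a b)]
  have hF' : Summable fun ut : Site (d + 1) × Site (d + 1) => σ ut.2 * colH K N ν ut.2 κ'' ut.1 * S κ'' ut.1 x z a b :=
    ((Equiv.prodComm (Site (d + 1)) (Site (d + 1))).summable_iff.2 (hF κ'')).congr fun ut => by simp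
  simp only [Equiv.prodComm_apply, Prod.fst_swap, Prod.snd_swap]
  rw [hF'.tsum_prod]
  refine tsum_congr fun u => ?_
  rw [← tsum_mul_right]

end Summit.QuantumFields.BalabanUV.Beta.GAN24.SlotWeightedVertex

end
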